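import Literature.Computability.Cryptography.WordRAMInline2
import HarnessLib

/-!
# The word RAM — inline simulation of oracle calls, III: the simulating machine

The machine `SIM M k M_B k_B` that runs the fine-grained reduction `M` (word-size constant `k`)
with every oracle call answered by an inline run of the oracle-free algorithm `M_B` (word-size
constant `k_B`), and its specification `run_SIM`: prologue (`…WordRAMInline1.run_PRO`), the
step-by-step emulation of `M` (`…WordRAMEmulator.emu_step` for ordinary instructions,
`…WordRAMInline2.run_QB` for `query`), epilogue (`run_EPI`). The cost is
`proCost |x| W + 38 · t + Σ_{queries q} qbCost |q| W (s q) |O q| + epiCost |output|`, i.e. linear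
in the reduction's time, the total query length, the inline running times and the total answer
length, plus `O(log W)` per query — the accounting of V. Vassilevska Williams, ICM 2018, §2,
remark after Def. 2.1. Also: query logs only grow along runs (`run_queries_prefix`), and the
value bound of a run under a genuine oracle whose answers are short (`run_memLE_of_queries`).

## References

* V. Vassilevska Williams, *On some fine-grained questions in algorithms and complexity*,
  Proc. ICM 2018, §2 (Def. 2.1 and the remark following it).
-/

namespace Literature.Computability.Cryptography.WordRAM

open StateTransition

/-! ## Query logs and value bounds along oracle runs -/

section source

variable {P : Program} {w : ℕ} {O : List ℕ → List ℕ} {ρ : ℕ → ℕ}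

/-- One step either leaves the query log alone or (on a `query`) appends the query segment. [folklore] -/
theorem step_queries {c c' : Cfg} (hs : step P w O ρ c = some c') :
    c'.queries = c.queries ∨
      ∃ i qa ql aa, c.pc = some i ∧ P[i]? = some (.query qa ql aa) ∧
        c'.queries = c.queries ++ [readSeg c.mem (qa.read c.mem) (ql.read c.mem)] := by
  unfold step at hs
  cases hpc : c.pc with
  | none => simp [hpc] at hs
  | some i =>
    simp only [hpc] at hs
    cases hI : P[i]? with
    | none => simp only [hI, Option.some.injEq] at hs; subst hs; exact Or.inl rfl
    | some I =>
      simp only [hI] at hs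
      cases I with
      | halt => simp only [Option.some.injEq] at hs; subst hs; exact Or.inl rfl
      | jmp t => simp only [Option.some.injEq] at hs; subst hs; exact Or.inl rfl
      | jz x t => simp only [Option.some.injEq] at hs; subst hs; exact Or.inl rfl
      | op o dst x y => simp only [Option.some.injEq] at hs; subst hs; exact Or.inl rfl
      | rand dst => simp only [Option.some.injEq] at hs; subst hs; exact Or.inl rfl
      | query qa ql aa =>
        simp only [Option.some.injEq] at hs; subst hs
        exact Or.inr ⟨i, qa, ql, aa, rfl, hI, rfl⟩

/-- The query log only grows in one step. [folklore] -/
theorem step_queries_prefix {c c' : Cfg} (hs : step P w O ρ c = some c') :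
    c.queries <+: c'.queries := by
  rcases step_queries hs with h | ⟨_, _, _, _, _, _, h⟩
  · rw [h]
  · rw [h]; exact List.prefix_append _ _

/-- The query log grows by at most one query per step. [folklore] -/
theorem step_queries_length {c c' : Cfg} (hs : step P w O ρ c = some c') :
    c'.queries.length ≤ c.queries.length + 1 := by
  rcases step_queries hs with h | ⟨_, _, _, _, _, _, h⟩
  · rw [h]; exact Nat.le_succ _
  · rw [h, List.length_append, List.length_singleton]

/-- **Query logs only grow along runs.** [folklore] -/
theorem run_queries_prefix : ∀ (n : ℕ) {c c' : Cfg}, run P w O ρ n c = some c' →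
    c.queries <+: c'.queries
  | 0, c, c', h => by simp only [run_zero, Option.some.injEq] at h; subst h; exact List.prefix_rfl
  | n + 1, c, c', h => by
      rw [run_succ] at h
      cases hs : step P w O ρ c with
      | none => rw [hs] at h; exact absurd h (by simp)
      | some d =>
        rw [hs, Option.bind_some] at h
        exact (step_queries_prefix hs).trans (run_queries_prefix n h)

/-- A run of `n` steps makes at most `n` queries. [folklore] -/
theorem run_queries_length : ∀ (n : ℕ) {c c' : Cfg}, run P w O ρ n c = some c' →
    c'.queries.length ≤ c.queries.length + n
  | 0, c, c', h => by simp only [run_zero, Option.some.injEq] at h; subst h; simp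
  | n + 1, c, c', h => by
      rw [run_succ] at h
      cases hs : step P w O ρ c with
      | none => rw [hs] at h; exact absurd h (by simp)
      | some d =>
        rw [hs, Option.bind_some] at h
        have := run_queries_length n h; have := step_queries_length hs; omega

/-- **Values stay bounded under a genuine oracle with short answers.** One step preserves
`MemLE V` (`V ≥ 2 ^ w - 1`, `V ≥ P.maxConst`, `V ≥ 1`) provided every query in the log of the
successor has an answer of length `≤ V` (only the answer *length* is written unreduced). [folklore] -/
theorem step_memLE_of_queries {V : ℕ} (hw : 2 ^ w - 1 ≤ V) (h1 : 1 ≤ V)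
    (hP : Program.maxConst P ≤ V) {c c' : Cfg} (hc : MemLE V c.mem)
    (hs : step P w O ρ c = some c') (hq : ∀ q ∈ c'.queries, (O q).length ≤ V) : MemLE V c'.mem := by
  unfold step at hs
  cases hpc : c.pc with
  | none => simp [hpc] at hs
  | some i =>
    simp only [hpc] at hs
    cases hI : P[i]? with
    | none => simp only [hI, Option.some.injEq] at hs; subst hs; exact hc
    | some I =>
      have hIc : I.maxConst ≤ V := le_trans (Instr.maxConst_le_of_getElem? hI) hP
      simp only [hI] at hs
      cases I with
      | halt => simp only [Option.some.injEq] at hs; subst hs; exact hc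
      | jmp t => simp only [Option.some.injEq] at hs; subst hs; exact hc
      | jz x t => simp only [Option.some.injEq] at hs; subst hs; exact hc
      | op o dst x y =>
        simp only [Option.some.injEq] at hs; subst hs
        simp only [Instr.maxConst, max_le_iff] at hIc
        exact Operand.write_memLE hc (BinOp.eval_le (Operand.read_le hc x hIc.2.1) hw h1 o) dst
      | rand dst =>
        simp only [Option.some.injEq] at hs; subst hs
        exact Operand.write_memLE hc (le_trans (mod_two_pow_le _ _) hw) dst
      | query qa ql aa =>
        simp only [Option.some.injEq] at hs
        subst hs
        simp only at hq ⊢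
        have hlen := hq _ (List.mem_append_right _ (List.mem_singleton_self _))
        refine writeSeg_memLE _ _ _ (fun b => ?_) fun v hv => ?_
        · rcases eq_or_ne b (aa.read c.mem) with rfl | h
          · rw [Function.update_self, List.length_map]; exact hlen
          · rw [Function.update_of_ne h]; exact hc b
        · obtain ⟨u, -, rfl⟩ := List.mem_map.1 hv
          exact le_trans (mod_two_pow_le _ _) hw

/-- The value bound along a run under a genuine oracle with short answers. [folklore] -/
theorem run_memLE_of_queries {V : ℕ} (hw : 2 ^ w - 1 ≤ V) (h1 : 1 ≤ V)
    (hP : Program.maxConst P ≤ V) :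
    ∀ (n : ℕ) {c c' : Cfg}, MemLE V c.mem → run P w O ρ n c = some c' →
      (∀ q ∈ c'.queries, (O q).length ≤ V) → MemLE V c'.mem
  | 0, c, c', hc, h, _ => by simp only [run_zero, Option.some.injEq] at h; subst h; exact hc
  | n + 1, c, c', hc, h, hq => by
      rw [run_add, Option.bind_eq_some_iff] at h
      obtain ⟨d, hd, hlast⟩ := h
      rw [run_one] at hlast
      have hpre := step_queries_prefix hlast
      exact step_memLE_of_queries hw h1 hP
        (run_memLE_of_queries hw h1 hP n hc hd fun q hq' => hq q (hpre.subset hq')) hlast hq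

end source

namespace Inline

/-! ## The simulating machine -/

/-- **The simulating machine** of the reduction `M` (word-size constant `k`) with the oracle
algorithm `M_B` (word-size constant `k_B`) inlined: prologue, the compiled `M` whose `query`
blocks are the query blocks `QB M_B k_B`, epilogue. [folklore] -/
def SIM (M : Program) (k : ℕ) (MB : Program) (kB : ℕ) : Program :=
  PRO k ++ compile LM (qlenM MB) M 88 (QB MB kB) ++ EPI (exitPos LM (qlenM MB) M 88)

section structural

/-- An instruction that is neither `rand` nor `query`. [folklore] -/
def Instr.Plain (I : Instr) : Prop := I.isRand = false ∧ I.isQuery = false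

/-- Straight-line operations are plain. [folklore] -/
theorem plain_of_mem_map {ops : List OpSpec} {I : Instr} (h : I ∈ ops.map OpSpec.toInstr) :
    Instr.Plain I := by
  obtain ⟨s, -, rfl⟩ := List.mem_map.1 h
  exact ⟨rfl, rfl⟩

/-- Loop blocks are plain. [folklore] -/
theorem plain_of_mem_loopBlock {i₀ RC : ℕ} {body : List OpSpec} {I : Instr}
    (h : I ∈ loopBlock i₀ RC body) : Instr.Plain I := by
  simp only [loopBlock, List.mem_append, List.mem_cons, List.mem_nil_iff, or_false] at h
  rcases h with (rfl | h) | rfl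
  · exact ⟨rfl, rfl⟩
  · exact plain_of_mem_map h
  · exact ⟨rfl, rfl⟩

/-- The width routine is plain. [folklore] -/
theorem plain_of_mem_widthCode {i₀ kk : ℕ} {I : Instr} (h : I ∈ widthCode i₀ kk) : Instr.Plain I := by
  simp only [widthCode, List.mem_append] at h
  rcases h with (((((h | h) | h) | h) | h) | h) | h
  exacts [plain_of_mem_map h, plain_of_mem_loopBlock h, plain_of_mem_map h, plain_of_mem_loopBlock h,
    plain_of_mem_map h, plain_of_mem_loopBlock h, plain_of_mem_map h]

/-- Compiled code is plain if the query blocks are. [folklore] -/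
theorem plain_of_mem_compile {L : Layout} {qlen : ℕ} {M : Program} {base : ℕ}
    {qb : ℕ → Operand → Operand → Operand → List Instr}
    (hqb : ∀ pos qa ql aa, ∀ I ∈ qb pos qa ql aa, Instr.Plain I) {I : Instr}
    (h : I ∈ compile L qlen M base qb) : Instr.Plain I := by
  simp only [compile, List.mem_flatten, List.mem_map, List.mem_range] at h
  obtain ⟨_, ⟨i, -, rfl⟩, hI⟩ := h
  simp only [blkAt] at hI
  split at hI
  · exact plain_of_mem_map hI
  · simp only [List.mem_singleton] at hI; subst hI; exact ⟨rfl, rfl⟩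
  · simp only [List.mem_append, List.mem_singleton] at hI
    rcases hI with hI | rfl
    · exact plain_of_mem_map hI
    · exact ⟨rfl, rfl⟩
  · simp only [List.mem_singleton] at hI; subst hI; exact ⟨rfl, rfl⟩
  · simp only [List.mem_singleton] at hI; subst hI; exact ⟨rfl, rfl⟩
  · exact hqb _ _ _ _ _ hI
  · simp at hI

/-- Query blocks are plain. [folklore] -/
theorem plain_of_mem_QB {MB : Program} {kB pos : ℕ} {qa ql aa : Operand} {I : Instr}
    (h : I ∈ QB MB kB pos qa ql aa) : Instr.Plain I := by
  simp only [QB, List.mem_append] at h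
  rcases h with (((((((h | h) | h) | h) | h) | h) | h) | h) | h
  exacts [plain_of_mem_map h, plain_of_mem_map h, plain_of_mem_widthCode h, plain_of_mem_map h,
    plain_of_mem_map h, plain_of_mem_loopBlock h, plain_of_mem_compile (fun _ _ _ _ _ hI => by simp [qb0] at hI) h,
    plain_of_mem_map h, plain_of_mem_loopBlock h]

/-- The prologue is plain. [folklore] -/
theorem plain_of_mem_PRO {k : ℕ} {I : Instr} (h : I ∈ PRO k) : Instr.Plain I := by
  simp only [PRO, List.mem_append] at h
  rcases h with ((((((((h | h) | h) | h) | h) | h) | h) | h) | h) | h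
  exacts [plain_of_mem_map h, plain_of_mem_map h, plain_of_mem_loopBlock h, plain_of_mem_map h,
    plain_of_mem_map h, plain_of_mem_map h, plain_of_mem_widthCode h, plain_of_mem_map h,
    plain_of_mem_loopBlock h, plain_of_mem_map h]

/-- The epilogue is plain. [folklore] -/
theorem plain_of_mem_EPI {pos : ℕ} {I : Instr} (h : I ∈ EPI pos) : Instr.Plain I := by
  simp only [EPI, List.mem_append] at h
  rcases h with ((((h | h) | h) | h) | h) | h
  exacts [plain_of_mem_map h, plain_of_mem_loopBlock h, plain_of_mem_map h, plain_of_mem_loopBlock h,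
    plain_of_mem_map h, by simp only [List.mem_singleton] at h; subst h; exact ⟨rfl, rfl⟩]

/-- Every instruction of the simulating machine is plain. [folklore] -/
theorem plain_of_mem_SIM {M : Program} {k : ℕ} {MB : Program} {kB : ℕ} {I : Instr}
    (h : I ∈ SIM M k MB kB) : Instr.Plain I := by
  simp only [SIM, List.mem_append] at h
  rcases h with (h | h) | h
  exacts [plain_of_mem_PRO h, plain_of_mem_compile (fun _ _ _ _ _ hI => plain_of_mem_QB hI) h,
    plain_of_mem_EPI h]

/-- **The simulating machine is deterministic.** [folklore] -/
theorem SIM_isDeterministic (M : Program) (k : ℕ) (MB : Program) (kB : ℕ) :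
    (SIM M k MB kB).IsDeterministic := fun _ h => (plain_of_mem_SIM h).1

/-- **The simulating machine is oracle-free.** [folklore] -/
theorem SIM_isOracleFree (M : Program) (k : ℕ) (MB : Program) (kB : ℕ) :
    (SIM M k MB kB).IsOracleFree := fun _ h => (plain_of_mem_SIM h).2

/-- Placement of the three parts of the simulating machine. [folklore] -/
theorem codeAt_SIM (M : Program) (k : ℕ) (MB : Program) (kB : ℕ) :
    CodeAt (SIM M k MB kB) 0 (PRO k) ∧
      CodeAt (SIM M k MB kB) 88 (compile LM (qlenM MB) M 88 (QB MB kB)) ∧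
      CodeAt (SIM M k MB kB) (exitPos LM (qlenM MB) M 88) (EPI (exitPos LM (qlenM MB) M 88)) := by
  have h := codeAt_self (SIM M k MB kB)
  conv at h => arg 3; rw [SIM]
  obtain ⟨h12, h3⟩ := codeAt_append_iff.1 h
  obtain ⟨h1, h2⟩ := codeAt_append_iff.1 h12
  simp only [PRO_length, Nat.zero_add, List.length_append] at h2 h3
  have hlen := length_compile (L := LM) (qlen := qlenM MB) (M := M) (base := 88) (qb := QB MB kB)
    (fun pos qa ql aa => QB_length MB kB pos qa ql aa)
  rw [show 88 + (compile LM (qlenM MB) M 88 (QB MB kB)).length = exitPos LM (qlenM MB) M 88 by omega] at h3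
  exact ⟨h1, h2, h3⟩

end structural

/-! ## The simulation invariant and one step of the reduction -/

section sim

variable {M MB : Program} {k kB W ws VT V VB : ℕ} {P : Program}

/-- The cost charged to a query `q`: its query block, with `s q` steps of `M_B` and the answer
`O q`. [folklore] -/
def charge (W : ℕ) (O : List ℕ → List ℕ) (s : List ℕ → ℕ) (q : List ℕ) : ℕ :=
  qbCost q.length W (s q) (O q).length

/-- **The simulation invariant** between a configuration `d` of the reduction `M` (run at word
size `ws` with the oracle) and a configuration `e` of the simulating machine (word size `W`):
the emulation relation of `M`, the `B`-side between calls at generation `|d.queries|`, and the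
generation register. [folklore] -/
def SimInv (W ws VT : ℕ) (M MB : Program) (d e : Cfg) : Prop :=
  ERel LM (EM W ws) VT M 88 (qlenM MB) d e ∧ BPre W d.queries.length e.mem ∧
    e.mem 10 = d.queries.length

/-- **One step of the reduction, simulated.** From `SimInv d e` with `d` `V`-bounded, one source
step `d → d'` (word size `ws`, oracle `O`) is matched by a target run to some `e'` with
`SimInv d' e'`; an ordinary instruction costs at most `cstep`, a `query q` additionally
`charge W O s q`, provided `M_B` computes `O q` on `q` within `s q` steps at word size
`k_B · inputWidth q`. [folklore] -/
theorem sim_step (hcode : CodeAt P 88 (compile LM (qlenM MB) M 88 (QB MB kB)))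
    (hws : ws < W) (hVT : VT + 1 = 2 ^ W)
    (hdet : M.IsDeterministic) (hBdet : MB.IsDeterministic) (hBof : MB.IsOracleFree)
    (hMV : Program.maxConst M ≤ V) (hV1 : 1 ≤ V) (hVQ : 2 * V + 42 ≤ Qv W - 40)
    (hkB : kB * Nat.size V < W) (hVB : 2 ^ (kB * Nat.size V) ≤ VB) (hMBc : Program.maxConst MB ≤ VB)
    (hVBQ : VB < Qv W)
    {O : List ℕ → List ℕ} {s : List ℕ → ℕ} {d d' e : Cfg} (hinv : SimInv W ws VT M MB d e)
    (hdm : MemLE V d.mem) (hstep : step M ws O zeroCoins d = some d')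
    (hgT : d.queries.length + 1 ≤ VT)
    (hO : ∀ q ∈ d'.queries, (O q).length ≤ V)
    (hMB : ∀ q ∈ d'.queries, ∃ cB, HaltsWithin MB (kB * inputWidth q) noOracle zeroCoins q (s q) cB ∧
      readOut cB.mem = O q)
    (O' : List ℕ → List ℕ) (ρ' : ℕ → ℕ) :
    ∃ n e', run P W O' ρ' n e = some e' ∧ SimInv W ws VT M MB d' e' ∧
      n + (d.queries.map (charge W O s)).sum ≤ cstep + (d'.queries.map (charge W O s)).sum := by
  have hW : 8 ≤ W := eight_le_of_Qv (by omega)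
  have hQ := Qv_ge hW
  have h4Q := four_mul_Qv (show 2 ≤ W by omega)
  have hVT1 : 1 ≤ VT := by
    have : 2 ^ 8 ≤ 2 ^ W := Nat.pow_le_pow_right (by norm_num) hW
    omega
  have hVVT : V ≤ VT := by omega
  have hOKM := envOK_M hW hws.le
  have hqb : ∀ pos qa ql aa, (QB MB kB pos qa ql aa).length = qlenM MB :=
    fun pos qa ql aa => QB_length MB kB pos qa ql aa
  obtain ⟨hrel, hpre, h10⟩ := hinv
  -- is the source step a query?
  by_cases hnq : ∀ i qa ql aa, d.pc = some i → M[i]? ≠ some (.query qa ql aa)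
  · -- ordinary instruction: the emulator step
    obtain ⟨n, hn, e', hrun, hrel', -, -, hfr⟩ := emu_step (L := LM) (E := EM W ws) hOKM hVT hVT1
      (LM_regs_le (by omega)) hqb hcode hdet hMV (by simp only [EM_Q]; omega) hVVT O' ρ' hrel hdm
      hstep hnq
    have hqs : d'.queries = d.queries := by
      rcases step_queries hstep with h | ⟨i, qa, ql, aa, hpc, hMi, -⟩
      · exact h
      · exact absurd hMi (hnq i qa ql aa hpc)
    refine ⟨n, e', hrun, ⟨hrel', ?_, ?_⟩, by rw [hqs]; omega⟩
    · rw [hqs]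
      exact hpre.of_frame fun c hc => hfr c fun hf => by have := foot_M hW hf; omega
    · rw [hqs, hfr 10 fun hf => by have := foot_M hW hf; omega, h10]
  · -- a query: the query block
    simp only [not_forall, not_not, exists_prop] at hnq
    obtain ⟨i, qa, ql, aa, hpc, hMi⟩ := hnq
    have hi : i < M.length := (List.getElem?_eq_some_iff.1 hMi).1
    rw [step_query hpc hMi] at hstep
    simp only [Option.some.injEq] at hstep
    subst hstep
    simp only at hO hMB ⊢
    have hqmem : readSeg d.mem (qa.read d.mem) (ql.read d.mem) ∈
        d.queries ++ [readSeg d.mem (qa.read d.mem) (ql.read d.mem)] :=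
      List.mem_append_right _ (List.mem_singleton_self _)
    obtain ⟨cB, hrunB, houtB⟩ := hMB _ hqmem
    have hoV := hO _ hqmem
    -- constants of the query instruction
    have hIc : (Instr.query qa ql aa).maxConst ≤ V := le_trans (Instr.maxConst_le_of_getElem? hMi) hMV
    simp only [Instr.maxConst, max_le_iff] at hIc
    -- placement of the query block
    have hblk := codeAt_blkAt (L := LM) (qlen := qlenM MB) (base := 88) (qb := QB MB kB) hqb hcode hi
    simp only [blkAt, hMi] at hblk
    have hpce : e.pc = some (bstart LM (qlenM MB) M 88 i) := by rw [hrel.pc, hpc]; rfl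
    obtain ⟨n, hn, e', hrun, hpc', hM', ⟨wsB, hB'⟩, h10', -, -⟩ := run_QB (W := W) (ws := ws) (VT := VT)
      (V := V) hblk hws hVT hBdet hBof hpce ⟨hrel.inv, hrel.agree⟩ hpre h10 hdm hIc.1 hIc.2.1
      hIc.2.2 hV1 hrunB houtB hoV hVQ hgT hkB hVB hMBc hVBQ O' ρ'
    refine ⟨n, e', hrun, ⟨⟨?_, hM'.2, hM'.1⟩, ?_, ?_⟩, ?_⟩
    · rw [hpc']
      simp only [Option.getD_some]
      rw [bstart_succ hi]
      simp [blkLenAt, hMi, blkLen]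
    · simpa only [List.length_append, List.length_singleton] using hB'.bpre
    · simpa only [List.length_append, List.length_singleton] using h10'
    · simp only [List.map_append, List.map_cons, List.map_nil, List.sum_append, List.sum_cons,
        List.sum_nil, Nat.add_zero, charge, readSeg_length]
      have : cstep = 38 := rfl
      omega

/-- **The run of the reduction, simulated.** `n` source steps from `SimInv d₀ e₀` (source
`V`-bounded, `2 ^ ws - 1 ≤ V`) are matched by a target run to some `en` with `SimInv dn en`, at
cost `cstep · n` plus the charges of the queries made, provided every query in the final log has a
short answer that `M_B` computes. [folklore] -/
theorem sim_run (hcode : CodeAt P 88 (compile LM (qlenM MB) M 88 (QB MB kB)))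
    (hws : ws < W) (hVT : VT + 1 = 2 ^ W)
    (hdet : M.IsDeterministic) (hBdet : MB.IsDeterministic) (hBof : MB.IsOracleFree)
    (hMV : Program.maxConst M ≤ V) (hV1 : 1 ≤ V) (hwsV : 2 ^ ws - 1 ≤ V) (hVQ : 2 * V + 42 ≤ Qv W - 40)
    (hkB : kB * Nat.size V < W) (hVB : 2 ^ (kB * Nat.size V) ≤ VB) (hMBc : Program.maxConst MB ≤ VB)
    (hVBQ : VB < Qv W)
    {O : List ℕ → List ℕ} {s : List ℕ → ℕ} {d₀ e₀ : Cfg} (hinv : SimInv W ws VT M MB d₀ e₀)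
    (hdm : MemLE V d₀.mem) (O' : List ℕ → List ℕ) (ρ' : ℕ → ℕ) :
    ∀ (n : ℕ) {dn : Cfg}, run M ws O zeroCoins n d₀ = some dn → dn.queries.length + 1 ≤ VT →
      (∀ q ∈ dn.queries, (O q).length ≤ V) →
      (∀ q ∈ dn.queries, ∃ cB, HaltsWithin MB (kB * inputWidth q) noOracle zeroCoins q (s q) cB ∧
        readOut cB.mem = O q) →
      ∃ m en, run P W O' ρ' m e₀ = some en ∧ SimInv W ws VT M MB dn en ∧
        m + (d₀.queries.map (charge W O s)).sum ≤ cstep * n + (dn.queries.map (charge W O s)).sum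
  | 0, dn, h, _, _, _ => by
      simp only [run_zero, Option.some.injEq] at h
      subst h
      exact ⟨0, e₀, rfl, hinv, by simp⟩
  | n + 1, dn, h, hg, hO, hMB => by
      rw [run_add, Option.bind_eq_some_iff] at h
      obtain ⟨dm, hdm', hlast⟩ := h
      rw [run_one] at hlast
      have hpre := step_queries_prefix hlast
      have hlen := hpre.length_le
      obtain ⟨m, em, hrun, hinvm, hcost⟩ := sim_run hcode hws hVT hdet hBdet hBof hMV hV1 hwsV hVQ
        hkB hVB hMBc hVBQ hinv hdm O' ρ' n hdm' (by omega) (fun q hq => hO q (hpre.subset hq))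
        fun q hq => hMB q (hpre.subset hq)
      have hmemm : MemLE V dm.mem :=
        run_memLE_of_queries hwsV hV1 hMV n hdm hdm' fun q hq => hO q (hpre.subset hq)
      obtain ⟨m', e', hrun', hinv', hcost'⟩ := sim_step hcode hws hVT hdet hBdet hBof hMV hV1 hVQ
        hkB hVB hMBc hVBQ hinvm hmemm hlast (by omega) hO hMB O' ρ'
      exact ⟨m + m', e', run_add_of_run _ _ _ _ hrun hrun', hinv', by rw [Nat.mul_succ]; omega⟩

/-! ## The whole simulation -/

/-- The cost of the simulating machine: prologue, `cstep` per step of the reduction, the charges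
of the queries, epilogue. [folklore] -/
def simCost (L W t : ℕ) (charges : ℕ) (ℓ : ℕ) : ℕ :=
  proCost L W + cstep * t + charges + epiCost ℓ

/-- **Specification of the simulating machine.** Let the deterministic reduction `M`, run on `x`
at word size `k · inputWidth x` with oracle `O`, halt within `t` steps in `cM`; let every query
`q` in its log have an answer `O q` of length `≤ V` which the deterministic oracle-free `M_B`
outputs on `q` within `s q` steps at word size `k_B · inputWidth q`. Then, under the numeric side
conditions relating `V`, the constants of `M` and `M_B`, `t` and the target word size `W`, the
simulating machine run on `x` at word size `W` (any oracle, any coins) halts within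
`simCost |x| W t (Σ_q charge q) |readOut cM.mem|` steps with the same output as `M`. [folklore] -/
theorem run_SIM (hdet : M.IsDeterministic) (hBdet : MB.IsDeterministic) (hBof : MB.IsOracleFree)
    {x : List ℕ} (hw : inputWidth x ≤ W) (hk : k * inputWidth x < W)
    (hL : x.length + 83 ≤ Qv W)
    (hMV : Program.maxConst M ≤ V) (hV1 : 1 ≤ V) (hwsV : 2 ^ (k * inputWidth x) - 1 ≤ V)
    (hVQ : 2 * V + 121 ≤ Qv W - 40)
    (hkB : kB * Nat.size V < W) (hVB : 2 ^ (kB * Nat.size V) ≤ VB) (hMBc : Program.maxConst MB ≤ VB)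
    (hVBQ : VB < Qv W)
    {O : List ℕ → List ℕ} {t : ℕ} {cM : Cfg} (hM : HaltsWithin M (k * inputWidth x) O zeroCoins x t cM)
    (ht : t + 2 ≤ 2 ^ W) (hO : ∀ q ∈ cM.queries, (O q).length ≤ V) {s : List ℕ → ℕ}
    (hMB : ∀ q ∈ cM.queries, ∃ cB, HaltsWithin MB (kB * inputWidth q) noOracle zeroCoins q (s q) cB ∧
      readOut cB.mem = O q)
    (O' : List ℕ → List ℕ) (ρ' : ℕ → ℕ) :
    ∃ n c', run (SIM M k MB kB) W O' ρ' n (init W x) = some c' ∧ c'.pc = none ∧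
      readOut c'.mem = readOut cM.mem ∧
      n ≤ simCost x.length W t ((cM.queries.map (charge W O s)).sum) (readOut cM.mem).length := by
  have hW : 8 ≤ W := eight_le_of_Qv (by omega)
  have hQ := Qv_ge hW
  have h4Q := four_mul_Qv (show 2 ≤ W by omega)
  set ws := k * inputWidth x with hws
  set VT := 2 ^ W - 1 with hVTdef
  have hVT : VT + 1 = 2 ^ W := by
    have : 1 ≤ 2 ^ W := Nat.one_le_two_pow; omega
  obtain ⟨cPRO, cCMP, cEPI⟩ := codeAt_SIM M k MB kB
  -- the prologue
  obtain ⟨n₁, hn₁, mem₁, r₁, hreg, hzero, e4, e5, e6, e7, e8, e9, e10, hword⟩ :=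
    run_PRO (P := SIM M k MB kB) (O := O') (ρ := ρ') cPRO hw hk hL
  -- the initial invariant
  have hst : StampLE (EM W ws) mem₁ := fun a ha => by
    simp only [EM_Sv, EM_Gv]; rw [hzero _ (by omega)]
  have hT₁ : MemLE VT mem₁ := fun a => by have := hword a; omega
  have hpre₁ : BPre W 0 mem₁ := ⟨e8, e9, fun a ha => by rw [hzero _ (by omega)]⟩
  have hinv₀ : SimInv W ws VT M MB (init ws x) ⟨some 88, mem₁, 0, []⟩ := by
    refine ⟨⟨?_, fun a ha => ?_, ⟨⟨e4, e5, e6, e7⟩, hst, hT₁⟩⟩, by simpa using hpre₁, by simpa using e10⟩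
    · simp [bstart_zero]
    · simp only [EM_Q] at ha
      show edec (EM W ws) mem₁ a = (init ws x).mem a
      rw [edec_M_eq hst ha, hreg a ha]
  -- the run of the reduction
  obtain ⟨nM, hnM, hrunM, hstepM⟩ := hM.exists_run
  have hhalt : cM.pc = none := (step_eq_none_iff _ _ _ _ _).1 hstepM
  have hqlen : cM.queries.length ≤ nM := by simpa using run_queries_length nM hrunM
  obtain ⟨n₂, e₂, r₂, ⟨hrel₂, hpre₂, -⟩, hcost₂⟩ := sim_run (P := SIM M k MB kB) cCMP hk hVT hdet hBdet
    hBof hMV hV1 hwsV (by omega) hkB hVB hMBc hVBQ hinv₀ (init_memLE ws x hwsV) O' ρ' nM hrunM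
    (by omega) hO hMB
  have hmemM : MemLE V cM.mem := run_memLE_of_queries hwsV hV1 hMV nM (init_memLE ws x hwsV) hrunM hO
  -- the epilogue
  have hpc₂ : e₂.pc = some (exitPos LM (qlenM MB) M 88) := by
    rw [hrel₂.pc, hhalt, Option.getD_none, exitPos]
  have h40 : e₂.mem 40 = cM.mem 0 := by
    have := hrel₂.agree 0 (by simp only [EM_Q]; omega)
    rwa [edec_M_eq hrel₂.inv.stamp (by omega), Nat.add_zero] at this
  have hℓ : cM.mem 0 ≤ V := hmemM 0
  obtain ⟨n₃, hn₃, c', r₃, hpc₃, -, -, h0, hout⟩ := run_EPI (P := SIM M k MB kB) (O := O') (ρ := ρ')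
    cEPI hpc₂ (fun a => by have := hrel₂.inv.memT a; omega) hpre₂.1 h40 (by omega)
  refine ⟨n₁ + (n₂ + n₃), c', run_add_of_run _ _ _ _ r₁ (run_add_of_run _ _ _ _ r₂ r₃), hpc₃, ?_, ?_⟩
  · simp only [readOut, h0]
    refine readSeg_congr fun j hj => ?_
    rw [hout (1 + j) (by omega) (by omega), show 40 + (1 + j) = 40 + (1 + j) from rfl]
    have := hrel₂.agree (1 + j) (by simp only [EM_Q]; omega)
    rwa [edec_M_eq hrel₂.inv.stamp (by omega)] at this
  · simp only [simCost, readOut_length, List.map_nil, List.sum_nil, Nat.add_zero, init_queries] at hcost₂ ⊢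
    have := Nat.mul_le_mul_left cstep hnM
    omega

/-- **The simulating machine outputs what the reduction outputs**, within `T` steps for any
`T ≥ simCost …` (packaged as `OutputsWithin`). [folklore] -/
theorem outputsWithin_SIM (hdet : M.IsDeterministic) (hBdet : MB.IsDeterministic)
    (hBof : MB.IsOracleFree)
    {x : List ℕ} (hw : inputWidth x ≤ W) (hk : k * inputWidth x < W)
    (hL : x.length + 83 ≤ Qv W)
    (hMV : Program.maxConst M ≤ V) (hV1 : 1 ≤ V) (hwsV : 2 ^ (k * inputWidth x) - 1 ≤ V)
    (hVQ : 2 * V + 121 ≤ Qv W - 40)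
    (hkB : kB * Nat.size V < W) (hVB : 2 ^ (kB * Nat.size V) ≤ VB) (hMBc : Program.maxConst MB ≤ VB)
    (hVBQ : VB < Qv W)
    {O : List ℕ → List ℕ} {t : ℕ} {cM : Cfg} (hM : HaltsWithin M (k * inputWidth x) O zeroCoins x t cM)
    (ht : t + 2 ≤ 2 ^ W) (hO : ∀ q ∈ cM.queries, (O q).length ≤ V) {s : List ℕ → ℕ}
    (hMB : ∀ q ∈ cM.queries, ∃ cB, HaltsWithin MB (kB * inputWidth q) noOracle zeroCoins q (s q) cB ∧
      readOut cB.mem = O q)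
    (O' : List ℕ → List ℕ) (ρ' : ℕ → ℕ) {T : ℕ}
    (hT : simCost x.length W t ((cM.queries.map (charge W O s)).sum) (readOut cM.mem).length ≤ T) :
    OutputsWithin (SIM M k MB kB) W O' ρ' x (readOut cM.mem) T := by
  obtain ⟨n, c', hrun, hpc, hout, hn⟩ := run_SIM hdet hBdet hBof hw hk hL hMV hV1 hwsV hVQ hkB hVB
    hMBc hVBQ hM ht hO hMB O' ρ'
  rw [← hout]
  exact outputsWithin_of_run hrun ((step_eq_none_iff _ _ _ _ _).2 hpc) (hn.trans hT)

end sim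

end Inline

end Literature.Computability.Cryptography.WordRAM
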